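import Summits.ResolutionOfSingularities.KangarooAtlas.MizutaniCoordChange
import Summits.ResolutionOfSingularities.KangarooAtlas.MizutaniRationalPoints
import Literature.AlgebraicGeometry.ProjectiveSpace.LinearChangeOfCoordinates
import HarnessLib

/-!
# Projective coordinate changes on HIRONAKA's side: `U(𝔭)`, `U_+(𝔭)S`, «vector group», «point» are `GL_{n+1}(k)`-equivariant

Cell `pub-rosobs`, Mizutani enclosure (seat mizutani-encloser-2, gen 9). AI-written; *AI review is weaker than expert
review*; NOT a resolution-of-singularities theorem (summit relevance C).

`MizutaniCoordChange.lean` (gen 8) proved that ODA's dictionary (`invForms`, `ExponentLE`, `exponent`, `hsDim`) is equivariant under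
the projective coordinate change `σ_B : X_i ↦ Σ_j B_{ij} X_j` (`B ∈ GL_{n+1}(k)`), so that Mizutani's «type» (Nagoya Math. J. 52 (1973)
p. 87) is a projective invariant of those objects.  This file does the same for HIRONAKA's objects of Def. 1.1 — the
multiplicity condition `mult_𝔭(f) ≥ d` (`symbPow`), the algebra `U(𝔭)` (`multAlgebra`), the ideal `U_+(𝔭)S` of `B_{P,𝔭}` (`bIdeal`),
«`B_{P,𝔭}` is a vector group» (`IsVectorGroup`) and «point of `ℙ^n`» (`IsPoint`) — with `σ_B = aeval B.toMvPolynomial` of the tree's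
`Literature/…/ProjectiveSpace/LinearChangeOfCoordinates` (`= aeval (linForm (B ·))`, `toMvPolynomial_eq_linForm`):

* `comap_aeval_toMvPolynomial_eq_map` (`σ_B^{-1}(J) = σ_{B⁻¹}(J)`), `comap_aeval_toMvPolynomial_pow`;
* **`mem_symbPow_comap_aeval_iff`** — `mult_{σ_B^{-1}𝔭}(f) ≥ d ↔ mult_𝔭(σ_B f) ≥ d`; `isHomogeneous_aeval_toMvPolynomial_iff`;
  **`mem_multAlgebra_comap_aeval_iff`** — `f ∈ U(σ_B^{-1}𝔭) ↔ σ_B f ∈ U(𝔭)`; `constantCoeff_aeval_toMvPolynomial`;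
* **`bIdeal_comap_aeval`** — `U_+(σ_B^{-1}𝔭)S = σ_B^{-1}(U_+(𝔭)S)`: **`B_{P,σ_B^{-1}𝔭} = σ_B^*(B_{P,𝔭})`**, hence
  `ringKrullDim_quotient_bIdeal_comap_aeval` (`dim B` is a projective invariant on Hironaka's side too),
  **`isVectorGroup_comap_aeval_iff`**, **`isPoint_comap_aeval_iff`**, `mem_hirForms_comap_aeval_iff` (`(U ∩ L)_e` twists by `B^{[p^e]}`).

With `MizutaniCoordChange` this makes every object in Thm. 2.8's «same type as Example 2.1» (`extremal_iff_type_hironaka`,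
`extremal_iff_exists_coordChange_attP`) a projective invariant on both sides of the dictionary.

## References

* H. Mizutani, *Hironaka's additive group schemes*, Nagoya Math. J. 52 (1973) 85–95, Def. 1.1, p. 87 («type»), Thm. 2.8. [Mizutani1973HironakaGroupSchemes]
* T. Oda, *Hironaka's additive group scheme, II*, Publ. RIMS 19 (1983), §2. [Oda1983HironakaGroupSchemeII]
-/

noncomputable section

open MvPolynomial Literature.AlgebraicGeometry.Resolution Literature.AlgebraicGeometry.Resolution.HironakaScheme
  Literature.RingTheory.MvPolynomial Literature.AlgebraicGeometry.ProjectiveSpace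

namespace Summit.ResolutionOfSingularities.KangarooAtlas.Mizutani

universe u

section CoordChangeHironaka

variable (k : Type u) [Field k] {n : ℕ} {B : Matrix (Fin (n + 1)) (Fin (n + 1)) k}

/-- The tree's two spellings of `σ_B` agree: `B.toMvPolynomial = (linForm (B ·))`. [folklore] -/
theorem toMvPolynomial_eq_linForm (M : Matrix (Fin (n + 1)) (Fin (n + 1)) k) :
    M.toMvPolynomial = fun j => linForm (K := k) (M j) := by
  funext i
  rw [Matrix.toMvPolynomial, linForm_apply]
  refine Finset.sum_congr rfl fun j _ => ?_
  rw [X, smul_monomial, smul_eq_mul, mul_one]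

/-- **`σ_B^{-1}(J) = σ_{B⁻¹}(J)`** for `B` invertible (`σ_{B⁻¹} ∘ σ_B = id = σ_B ∘ σ_{B⁻¹}`). [folklore] -/
theorem comap_aeval_toMvPolynomial_eq_map (hB : IsUnit B.det) (J : Ideal (MvPolynomial (Fin (n + 1)) k)) :
    J.comap (aeval (R := k) B.toMvPolynomial) = J.map (aeval (R := k) B⁻¹.toMvPolynomial) := by
  refine le_antisymm (fun f hf => ?_) (Ideal.map_le_iff_le_comap.mpr fun g hg => ?_)
  · rw [← aeval_toMvPolynomial_inv_right hB f]
    exact Ideal.mem_map_of_mem _ (Ideal.mem_comap.mp hf)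
  · rw [Ideal.mem_comap, Ideal.mem_comap, aeval_toMvPolynomial_inv_left hB]
    exact hg

/-- `(σ_B^{-1} J)^d = σ_B^{-1}(J^d)`. [folklore] -/
theorem comap_aeval_toMvPolynomial_pow (hB : IsUnit B.det) (J : Ideal (MvPolynomial (Fin (n + 1)) k)) (d : ℕ) :
    (J.comap (aeval (R := k) B.toMvPolynomial)) ^ d = (J ^ d).comap (aeval (R := k) B.toMvPolynomial) := by
  rw [comap_aeval_toMvPolynomial_eq_map k hB, comap_aeval_toMvPolynomial_eq_map k hB, Ideal.map_pow]

/-- **The multiplicity condition is equivariant**: `mult_{σ_B^{-1}𝔭}(f) ≥ d ↔ mult_𝔭(σ_B f) ≥ d` (`symbPow`).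
[cite: Mizutani1973HironakaGroupSchemes, p. 85 L23–25 (U_m(p))] -/
theorem mem_symbPow_comap_aeval_iff (hB : IsUnit B.det) (𝔭 : Ideal (MvPolynomial (Fin (n + 1)) k)) (d : ℕ)
    (f : MvPolynomial (Fin (n + 1)) k) :
    f ∈ symbPow k (𝔭.comap (aeval (R := k) B.toMvPolynomial)) d ↔ aeval (R := k) B.toMvPolynomial f ∈ symbPow k 𝔭 d := by
  constructor
  · rintro ⟨s, hs, hsf⟩
    refine ⟨aeval (R := k) B.toMvPolynomial s, fun h => hs (Ideal.mem_comap.mpr h), ?_⟩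
    rw [comap_aeval_toMvPolynomial_pow k hB, Ideal.mem_comap, map_mul] at hsf
    exact hsf
  · rintro ⟨s, hs, hsf⟩
    refine ⟨aeval (R := k) B⁻¹.toMvPolynomial s, fun h => hs ?_, ?_⟩
    · rw [Ideal.mem_comap, aeval_toMvPolynomial_inv_left hB] at h
      exact h
    · rw [comap_aeval_toMvPolynomial_pow k hB, Ideal.mem_comap, map_mul, aeval_toMvPolynomial_inv_left hB]
      exact hsf

/-- `σ_B` preserves and reflects forms of degree `d`. [folklore] -/
theorem isHomogeneous_aeval_toMvPolynomial_iff (hB : IsUnit B.det) {f : MvPolynomial (Fin (n + 1)) k} {d : ℕ} :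
    (aeval (R := k) B.toMvPolynomial f).IsHomogeneous d ↔ f.IsHomogeneous d := by
  refine ⟨fun h => ?_, IsHomogeneous.aeval_toMvPolynomial B⟩
  have h' := IsHomogeneous.aeval_toMvPolynomial B⁻¹ h
  rwa [aeval_toMvPolynomial_inv_right hB] at h'

/-- The homogeneous elements of `U`: `f ∈ multGens (σ_B^{-1}𝔭) ↔ σ_B f ∈ multGens 𝔭`. [cite: Mizutani1973HironakaGroupSchemes, p. 85 L23–25] -/
theorem mem_multGens_comap_aeval_iff (hB : IsUnit B.det) (𝔭 : Ideal (MvPolynomial (Fin (n + 1)) k))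
    (f : MvPolynomial (Fin (n + 1)) k) :
    f ∈ multGens k (𝔭.comap (aeval (R := k) B.toMvPolynomial)) ↔ aeval (R := k) B.toMvPolynomial f ∈ multGens k 𝔭 := by
  constructor
  · rintro ⟨d, hd, hf⟩
    exact ⟨d, IsHomogeneous.aeval_toMvPolynomial B hd, (mem_symbPow_comap_aeval_iff k hB 𝔭 d f).mp hf⟩
  · rintro ⟨d, hd, hf⟩
    exact ⟨d, (isHomogeneous_aeval_toMvPolynomial_iff k hB).mp hd, (mem_symbPow_comap_aeval_iff k hB 𝔭 d f).mpr hf⟩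

/-- **`U(σ_B^{-1}𝔭) = σ_B^{-1} U(𝔭)`**: `f ∈ U(σ_B^{-1}𝔭) ↔ σ_B f ∈ U(𝔭)`. [cite: Mizutani1973HironakaGroupSchemes, p. 85 L21–25 (U(p))] -/
theorem mem_multAlgebra_comap_aeval_iff (hB : IsUnit B.det) (𝔭 : Ideal (MvPolynomial (Fin (n + 1)) k))
    (f : MvPolynomial (Fin (n + 1)) k) :
    f ∈ multAlgebra k (𝔭.comap (aeval (R := k) B.toMvPolynomial)) ↔ aeval (R := k) B.toMvPolynomial f ∈ multAlgebra k 𝔭 := by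
  unfold multAlgebra
  constructor
  · intro hf
    have hle : Algebra.adjoin k (multGens k (𝔭.comap (aeval (R := k) B.toMvPolynomial))) ≤
        (Algebra.adjoin k (multGens k 𝔭)).comap (aeval (R := k) B.toMvPolynomial) :=
      Algebra.adjoin_le fun g hg =>
        (Subalgebra.mem_comap _ _ _).mpr (Algebra.subset_adjoin ((mem_multGens_comap_aeval_iff k hB 𝔭 g).mp hg))
    exact (Subalgebra.mem_comap _ _ _).mp (hle hf)
  · intro hf
    have hle : Algebra.adjoin k (multGens k 𝔭) ≤
        (Algebra.adjoin k (multGens k (𝔭.comap (aeval (R := k) B.toMvPolynomial)))).comap (aeval (R := k) B⁻¹.toMvPolynomial) :=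
      Algebra.adjoin_le fun g hg => (Subalgebra.mem_comap _ _ _).mpr (Algebra.subset_adjoin
        ((mem_multGens_comap_aeval_iff k hB 𝔭 _).mpr (by rw [aeval_toMvPolynomial_inv_left hB]; exact hg)))
    have h := (Subalgebra.mem_comap _ _ _).mp (hle hf)
    rwa [aeval_toMvPolynomial_inv_right hB] at h

/-- `σ_B` preserves constant terms. [folklore] -/
theorem constantCoeff_aeval_toMvPolynomial (M : Matrix (Fin (n + 1)) (Fin (n + 1)) k) (f : MvPolynomial (Fin (n + 1)) k) :
    constantCoeff (aeval (R := k) M.toMvPolynomial f) = constantCoeff f := by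
  induction f using MvPolynomial.induction_on with
  | C a => rw [aeval_C, MvPolynomial.algebraMap_eq]
  | add f g hf hg => rw [map_add, map_add, map_add, hf, hg]
  | mul_X q i hq =>
    rw [map_mul, map_mul, map_mul, aeval_X, Matrix.toMvPolynomial_constantCoeff, constantCoeff_X, mul_zero,
      mul_zero]

/-- **`U_+(σ_B^{-1}𝔭)S = σ_B^{-1}(U_+(𝔭)S)`: the Hironaka scheme of the transformed point is the transform of the Hironaka scheme,
`B_{P,σ_B^{-1}𝔭} = σ_B^*(B_{P,𝔭})`.** [cite: Mizutani1973HironakaGroupSchemes, Def. 1.1] -/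
theorem bIdeal_comap_aeval (hB : IsUnit B.det) (𝔭 : Ideal (MvPolynomial (Fin (n + 1)) k)) :
    bIdeal k (𝔭.comap (aeval (R := k) B.toMvPolynomial)) = (bIdeal k 𝔭).comap (aeval (R := k) B.toMvPolynomial) := by
  unfold bIdeal
  conv_rhs => rw [comap_aeval_toMvPolynomial_eq_map k hB, Ideal.map_span]
  congr 1
  ext f
  constructor
  · rintro ⟨hU, hc⟩
    refine ⟨aeval (R := k) B.toMvPolynomial f, ⟨(mem_multAlgebra_comap_aeval_iff k hB 𝔭 f).mp hU, ?_⟩,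
      aeval_toMvPolynomial_inv_right hB f⟩
    show constantCoeff (aeval (R := k) B.toMvPolynomial f) = 0
    rw [constantCoeff_aeval_toMvPolynomial]
    exact hc
  · rintro ⟨g, ⟨hU, hc⟩, rfl⟩
    refine ⟨(mem_multAlgebra_comap_aeval_iff k hB 𝔭 _).mpr ?_, ?_⟩
    · rw [aeval_toMvPolynomial_inv_left hB]
      exact hU
    · show constantCoeff (aeval (R := k) B⁻¹.toMvPolynomial g) = 0
      rw [constantCoeff_aeval_toMvPolynomial]
      exact hc

/-- The algebra automorphism `σ_{B⁻¹}` with inverse `σ_B` (for `B` invertible). [folklore] -/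
theorem aeval_toMvPolynomial_bijective (hB : IsUnit B.det) :
    Function.Bijective (aeval (R := k) B.toMvPolynomial : MvPolynomial (Fin (n + 1)) k → MvPolynomial (Fin (n + 1)) k) :=
  ⟨aeval_toMvPolynomial_injective hB, aeval_toMvPolynomial_surjective hB⟩

/-- **`dim B_{P,𝔭}` is a projective invariant on Hironaka's side**: `ringKrullDim (S ⧸ U_+(σ_B^{-1}𝔭)S) = ringKrullDim (S ⧸ U_+(𝔭)S)`.
[cite: Mizutani1973HironakaGroupSchemes, Def. 1.1 and Thm. 1.3] -/
theorem ringKrullDim_quotient_bIdeal_comap_aeval (hB : IsUnit B.det) (𝔭 : Ideal (MvPolynomial (Fin (n + 1)) k)) :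
    ringKrullDim (MvPolynomial (Fin (n + 1)) k ⧸ bIdeal k (𝔭.comap (aeval (R := k) B.toMvPolynomial))) =
      ringKrullDim (MvPolynomial (Fin (n + 1)) k ⧸ bIdeal k 𝔭) := by
  set e : MvPolynomial (Fin (n + 1)) k ≃+* MvPolynomial (Fin (n + 1)) k :=
    RingEquiv.ofBijective (aeval (R := k) B⁻¹.toMvPolynomial : MvPolynomial (Fin (n + 1)) k →ₐ[k] MvPolynomial (Fin (n + 1)) k)
      (aeval_toMvPolynomial_bijective k (Matrix.isUnit_nonsing_inv_det_iff.mpr hB)) with he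
  have hmap : bIdeal k (𝔭.comap (aeval (R := k) B.toMvPolynomial)) =
      (bIdeal k 𝔭).map (e : MvPolynomial (Fin (n + 1)) k →+* MvPolynomial (Fin (n + 1)) k) := by
    rw [bIdeal_comap_aeval k hB, comap_aeval_toMvPolynomial_eq_map k hB]
    rfl
  exact (ringKrullDim_eq_of_ringEquiv (Ideal.quotientEquiv _ _ e hmap)).symm

/-- **«`B_{P,𝔭}` is a vector group» is a projective invariant.** [cite: Mizutani1973HironakaGroupSchemes, p. 85 L15 and Rem. 1.2] -/
theorem isVectorGroup_comap_aeval_iff (hB : IsUnit B.det) (𝔭 : Ideal (MvPolynomial (Fin (n + 1)) k)) :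
    IsVectorGroup k (𝔭.comap (aeval (R := k) B.toMvPolynomial)) ↔ IsVectorGroup k 𝔭 := by
  -- for any ideal `I` and invertible `C`: the linear part of `σ_C^{-1} I` is `σ_C^{-1}` of the linear part of `I`
  have key : ∀ {C : Matrix (Fin (n + 1)) (Fin (n + 1)) k} (_ : IsUnit C.det) (I : Ideal (MvPolynomial (Fin (n + 1)) k)),
      I = Ideal.span ((I : Set (MvPolynomial (Fin (n + 1)) k)) ∩
        (homogeneousSubmodule (Fin (n + 1)) k 1 : Set (MvPolynomial (Fin (n + 1)) k))) →
      I.comap (aeval (R := k) C.toMvPolynomial) =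
        Ideal.span ((I.comap (aeval (R := k) C.toMvPolynomial) : Set (MvPolynomial (Fin (n + 1)) k)) ∩
          (homogeneousSubmodule (Fin (n + 1)) k 1 : Set (MvPolynomial (Fin (n + 1)) k))) := by
    intro C hC I hI
    refine le_antisymm ?_ (Ideal.span_le.mpr fun f hf => hf.1)
    conv_lhs => rw [hI, comap_aeval_toMvPolynomial_eq_map k hC, Ideal.map_span]
    refine Ideal.span_mono ?_
    rintro _ ⟨g, ⟨hgI, hg1⟩, rfl⟩
    refine ⟨?_, ?_⟩
    · rw [SetLike.mem_coe, Ideal.mem_comap, aeval_toMvPolynomial_inv_left hC]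
      exact hgI
    · exact (mem_homogeneousSubmodule 1 _).mpr
        (IsHomogeneous.aeval_toMvPolynomial _ ((mem_homogeneousSubmodule 1 _).mp hg1))
  unfold IsVectorGroup
  rw [bIdeal_comap_aeval k hB]
  constructor
  · intro h
    -- apply `key` with `C = B⁻¹` to `I = σ_B^{-1}(U_+S)`; `σ_{B⁻¹}^{-1} σ_B^{-1} = id`
    have hB' : IsUnit B⁻¹.det := Matrix.isUnit_nonsing_inv_det_iff.mpr hB
    have h2 := key hB' _ h
    have hcc : ((bIdeal k 𝔭).comap (aeval (R := k) B.toMvPolynomial)).comap (aeval (R := k) B⁻¹.toMvPolynomial) = bIdeal k 𝔭 := by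
      ext f
      rw [Ideal.mem_comap, Ideal.mem_comap, aeval_toMvPolynomial_inv_left hB]
    rwa [hcc] at h2
  · exact key hB _

/-- **«Point of `ℙ^n_k`» (prime, homogeneous, `≠ S_+`) is a projective invariant.** [cite: Oda1983HironakaGroupSchemeII, §2 (p. 1168)] -/
theorem isPoint_comap_aeval (hB : IsUnit B.det) {𝔭 : Ideal (MvPolynomial (Fin (n + 1)) k)} (hP : IsPoint k 𝔭) :
    IsPoint k (𝔭.comap (aeval (R := k) B.toMvPolynomial)) := by
  haveI := hP.1
  refine ⟨Ideal.comap_isPrime _ _, fun f hf d => ?_, fun hle => hP.2.2 fun g hg => ?_⟩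
  · rw [Ideal.mem_comap, ← homogeneousComponent_aeval_toMvPolynomial]
    exact hP.2.1 _ (Ideal.mem_comap.mp hf) d
  · -- `σ_{B⁻¹} g ∈ S_+ ⊆ σ_B^{-1} 𝔭`, so `g = σ_B σ_{B⁻¹} g ∈ 𝔭`
    have hg' : aeval (R := k) B⁻¹.toMvPolynomial g ∈ irrelevant k n := by
      unfold irrelevant at hg ⊢
      rw [RingHom.mem_ker] at hg ⊢
      rw [constantCoeff_aeval_toMvPolynomial, hg]
    have h := Ideal.mem_comap.mp (hle hg')
    rwa [aeval_toMvPolynomial_inv_left hB] at h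

/-- … as an `iff`. [cite: Oda1983HironakaGroupSchemeII, §2 (p. 1168)] -/
theorem isPoint_comap_aeval_iff (hB : IsUnit B.det) (𝔭 : Ideal (MvPolynomial (Fin (n + 1)) k)) :
    IsPoint k (𝔭.comap (aeval (R := k) B.toMvPolynomial)) ↔ IsPoint k 𝔭 := by
  refine ⟨fun h => ?_, isPoint_comap_aeval k hB⟩
  have hB' : IsUnit B⁻¹.det := Matrix.isUnit_nonsing_inv_det_iff.mpr hB
  have h2 := isPoint_comap_aeval k hB' h
  have hcc : (𝔭.comap (aeval (R := k) B.toMvPolynomial)).comap (aeval (R := k) B⁻¹.toMvPolynomial) = 𝔭 := by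
    ext f
    rw [Ideal.mem_comap, Ideal.mem_comap, aeval_toMvPolynomial_inv_left hB]
  rwa [hcc] at h2

variable (p : ℕ) [hp : Fact p.Prime] [CharP k p]

/-- **`(U ∩ L)_e` twists by `B^{[p^e]}`**: `a ∈ (U(σ_B^{-1}𝔭) ∩ L)_e ↔ a ᵥ* B^{[p^e]} ∈ (U(𝔭) ∩ L)_e` (Oda's side `mem_invForms_comap_iff`
through `hirForms_eq_invForms`). [cite: Mizutani1973HironakaGroupSchemes, §1 (c); Oda1983HironakaGroupSchemeII, §2 (p. 1168)] -/
theorem mem_hirForms_comap_aeval_iff (hB : IsUnit B.det) (𝔭 : Ideal (MvPolynomial (Fin (n + 1)) k)) [𝔭.IsPrime] (e : ℕ)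
    (a : Fin (n + 1) → k) :
    (haveI : (𝔭.comap (aeval (R := k) B.toMvPolynomial)).IsPrime := Ideal.comap_isPrime _ _;
      a ∈ hirForms k p (𝔭.comap (aeval (R := k) B.toMvPolynomial)) e) ↔
      Matrix.vecMul a (B.map fun x => x ^ p ^ e) ∈ hirForms k p 𝔭 e := by
  have _ := hB
  haveI : (𝔭.comap (aeval (R := k) B.toMvPolynomial)).IsPrime := Ideal.comap_isPrime _ _
  rw [hirForms_eq_invForms, hirForms_eq_invForms 𝔭 e, toMvPolynomial_eq_linForm]
  exact mem_invForms_comap_iff k p B 𝔭 e a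

end CoordChangeHironaka

end Summit.ResolutionOfSingularities.KangarooAtlas.Mizutani

end
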